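import Summits.Schanuel.Schanuel.Theorems.SoloInformedPiELadder

/-!
# The real-graph sector of Schanuel's conjecture in rank two

Soloist file (`solo-Schanuel-informed`, 2026-08-19, s10). Bookkeeping only; no new transcendence
input.

Counting theorems of Pila–Wilkie type — and the 2026 conjecture of Binyamini, Hirata-Kohno,
Kawashima and Salant on counting points of a definable set lying on `k`-dimensional `ℚ`-varieties
(arXiv:2604.15189, Conjecture 1) — speak about REAL definable sets, e.g. the real surface
`X = {(x, y, eˣ cos y, eˣ sin y)} ⊂ ℝ⁴`, the graph of `exp` in real coordinates. This file records
the exact dictionary between that surface and rank two of Schanuel's conjecture: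

* `trdeg_expField_re_imI_eq_graph`: for real `x, y`,
  `trdeg ℚ(x, iy, eˣ, e^{iy}) = trdeg ℚ(x, y, eˣ cos y, eˣ sin y)`
  (both fields have the same algebraic closure as `ℚ(x, y, eˣ, cos y, sin y)`).
* `realGraphSector_iff`: Schanuel's inequality at every pair `(x, iy)` with `x, y ∈ ℝ ∖ {0}`
  (these pairs are automatically `ℚ`-linearly independent, `linearIndependent_re_imI`) is
  equivalent to: **no point of `X` off the two coordinate axes has transcendence degree `≤ 1`.**
  Rank two of Schanuel's conjecture implies it (`realGraphSector_of_schanuelRank_two`).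
* The axes are genuinely exceptional: the points `(0, π, -1, 0)` and `(1, 0, e, 0)` of `X` have
  transcendence degree `≤ 1` (`trdeg_realExpGraphField_zero_pi_le_one`,
  `trdeg_realExpGraphField_one_zero_le_one`); the corresponding pairs `(0, iπ)`, `(1, 0)` are
  `ℚ`-linearly dependent, so Schanuel's conjecture says nothing there.
* Corners: the point `(1, π, -e, 0)` is the algebraic independence of `e` and `π`
  (`two_le_trdeg_realExpGraphField_one_pi_iff`, via `two_le_trdeg_expField_one_piI_iff`), and the
  point `(log 2, π, -2, 0)` is the algebraic independence of `log 2` and `π`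
  (`two_le_trdeg_realExpGraphField_log_two_pi_iff`). Hence the sector statement contains both
  emblematic open pairs through `iπ` (`expOnePi_of_realGraphSector`, `logTwoPi_of_realGraphSector`).

Caution (arXiv:2604.15189, `k = 1`): for the surface `X` itself the "algebraic part" `X^{alg(1)}`
(points where `X` meets a complex algebraic surface in a curve) is ALL of `X` — the line `y = y₀`
of `X` lies in the plane `{x₂ = y₀, x₄ cos y₀ = x₃ sin y₀}` — so Conjecture 1 there is vacuous for
`X`; counting sees the points of `X` only through curves drawn on it, and the sector statement is
the point-wise content such a count would have to control (seat's atlas, E17). -/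

open Complex IntermediateField
open Literature.NumberTheory.Transcendental (ExpOnePiAlgebraicIndependent SchanuelRank)
open Literature.Barriers.Schanuel (trdeg_mono trdeg_adjoin_union_eq_of_isAlgebraic
  trdeg_adjoin_union_eq_of_isAlgebraic_adjoin isAlgebraic_I)

namespace Summit.Schanuel.Schanuel.Theorems

/-! ### The two coordinate fields of a point of the real graph of `exp` -/

/-- `ℚ(x, y, eˣ cos y, eˣ sin y)`: the field generated by the coordinates of the point of the real
surface `{(x, y, Re e^{x+iy}, Im e^{x+iy})} ⊂ ℝ⁴` above `(x, y)`. -/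
noncomputable def realExpGraphField (x y : ℝ) : IntermediateField ℚ ℂ :=
  adjoin ℚ ({(x : ℂ), (y : ℂ), ((Real.exp x * Real.cos y : ℝ) : ℂ),
    ((Real.exp x * Real.sin y : ℝ) : ℂ)} : Set ℂ)

/-- `ℚ(x, y, eˣ, cos y, sin y)` (polar coordinates of the same point). -/
noncomputable def realExpPolarField (x y : ℝ) : IntermediateField ℚ ℂ :=
  adjoin ℚ ({(x : ℂ), (y : ℂ), ((Real.exp x : ℝ) : ℂ), ((Real.cos y : ℝ) : ℂ),
    ((Real.sin y : ℝ) : ℂ)} : Set ℂ)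

/-- `e^{iy} = cos y + i sin y` with real-valued `cos`, `sin`. -/
theorem cexp_ofReal_mul_I (y : ℝ) :
    cexp ((y : ℂ) * I) = ((Real.cos y : ℝ) : ℂ) + ((Real.sin y : ℝ) : ℂ) * I := by
  rw [Complex.exp_mul_I, Complex.ofReal_cos, Complex.ofReal_sin]

/-- `eˣ` for real `x`, as a complex number. -/
theorem cexp_ofReal' (x : ℝ) : cexp (x : ℂ) = ((Real.exp x : ℝ) : ℂ) := by
  rw [Complex.ofReal_exp]

/-- `cos y = (e^{iy} + (e^{iy})⁻¹) / 2`. -/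
theorem ofReal_cos_eq (y : ℝ) :
    ((Real.cos y : ℝ) : ℂ) = (cexp ((y : ℂ) * I) + (cexp ((y : ℂ) * I))⁻¹) / 2 := by
  rw [Complex.ofReal_cos, Complex.cos, ← Complex.exp_neg, neg_mul]

/-- `sin y = ((e^{iy})⁻¹ - e^{iy}) i / 2`. -/
theorem ofReal_sin_eq (y : ℝ) :
    ((Real.sin y : ℝ) : ℂ) = ((cexp ((y : ℂ) * I))⁻¹ - cexp ((y : ℂ) * I)) * I / 2 := by
  rw [Complex.ofReal_sin, Complex.sin, ← Complex.exp_neg, neg_mul]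

/-- After adjoining `i`, `ℚ(x, iy, eˣ, e^{iy})` and `ℚ(x, y, eˣ, cos y, sin y)` coincide. -/
theorem adjoin_expPair_union_I_eq_polar (x y : ℝ) :
    adjoin ℚ ((Set.range ![(x : ℂ), (y : ℂ) * I] ∪ Set.range (cexp ∘ ![(x : ℂ), (y : ℂ) * I]))
      ∪ {I}) =
    adjoin ℚ (({(x : ℂ), (y : ℂ), ((Real.exp x : ℝ) : ℂ), ((Real.cos y : ℝ) : ℂ),
      ((Real.sin y : ℝ) : ℂ)} : Set ℂ) ∪ {I}) := by
  set A : Set ℂ := Set.range ![(x : ℂ), (y : ℂ) * I] ∪ Set.range (cexp ∘ ![(x : ℂ), (y : ℂ) * I])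
    with hA
  set P : Set ℂ := {(x : ℂ), (y : ℂ), ((Real.exp x : ℝ) : ℂ), ((Real.cos y : ℝ) : ℂ),
      ((Real.sin y : ℝ) : ℂ)} with hP
  apply le_antisymm
  · -- `A ∪ {i} ⊆ ℚ(P, i)`
    have hx : (x : ℂ) ∈ adjoin ℚ (P ∪ {I}) := subset_adjoin ℚ _ (Or.inl (by simp [hP]))
    have hy : (y : ℂ) ∈ adjoin ℚ (P ∪ {I}) := subset_adjoin ℚ _ (Or.inl (by simp [hP]))
    have he : ((Real.exp x : ℝ) : ℂ) ∈ adjoin ℚ (P ∪ {I}) :=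
      subset_adjoin ℚ _ (Or.inl (by simp [hP]))
    have hc : ((Real.cos y : ℝ) : ℂ) ∈ adjoin ℚ (P ∪ {I}) :=
      subset_adjoin ℚ _ (Or.inl (by simp [hP]))
    have hs : ((Real.sin y : ℝ) : ℂ) ∈ adjoin ℚ (P ∪ {I}) :=
      subset_adjoin ℚ _ (Or.inl (by simp [hP]))
    have hI : I ∈ adjoin ℚ (P ∪ {I}) := subset_adjoin ℚ _ (Or.inr rfl)
    rw [adjoin_le_iff]
    rintro w ((⟨i, rfl⟩ | ⟨i, rfl⟩) | hw)
    · fin_cases i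
      · exact hx
      · exact mul_mem hy hI
    · fin_cases i
      · show cexp (x : ℂ) ∈ adjoin ℚ (P ∪ {I})
        rw [cexp_ofReal']; exact he
      · show cexp ((y : ℂ) * I) ∈ adjoin ℚ (P ∪ {I})
        rw [cexp_ofReal_mul_I]; exact add_mem hc (mul_mem hs hI)
    · rw [Set.mem_singleton_iff.mp hw]; exact hI
  · -- `P ∪ {i} ⊆ ℚ(A, i)`
    have hx : (x : ℂ) ∈ adjoin ℚ (A ∪ {I}) := subset_adjoin ℚ _ (Or.inl (Or.inl ⟨0, rfl⟩))
    have hyI : (y : ℂ) * I ∈ adjoin ℚ (A ∪ {I}) := subset_adjoin ℚ _ (Or.inl (Or.inl ⟨1, rfl⟩))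
    have he : cexp (x : ℂ) ∈ adjoin ℚ (A ∪ {I}) := subset_adjoin ℚ _ (Or.inl (Or.inr ⟨0, rfl⟩))
    have heyI : cexp ((y : ℂ) * I) ∈ adjoin ℚ (A ∪ {I}) :=
      subset_adjoin ℚ _ (Or.inl (Or.inr ⟨1, rfl⟩))
    have hI : I ∈ adjoin ℚ (A ∪ {I}) := subset_adjoin ℚ _ (Or.inr rfl)
    have h2 : (2 : ℂ) ∈ adjoin ℚ (A ∪ {I}) := by exact_mod_cast (adjoin ℚ (A ∪ {I})).natCast_mem 2
    rw [adjoin_le_iff]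
    rintro w (hw | hw)
    · simp only [hP, Set.mem_insert_iff, Set.mem_singleton_iff] at hw
      rcases hw with rfl | rfl | rfl | rfl | rfl
      · exact hx
      · rw [show (y : ℂ) = -((y : ℂ) * I * I) by rw [mul_assoc, Complex.I_mul_I]; ring]
        exact neg_mem (mul_mem hyI hI)
      · rw [← cexp_ofReal']; exact he
      · rw [ofReal_cos_eq]; exact div_mem (add_mem heyI (inv_mem heyI)) h2
      · rw [ofReal_sin_eq]; exact div_mem (mul_mem (sub_mem (inv_mem heyI) heyI) hI) h2
    · rw [Set.mem_singleton_iff.mp hw]; exact hI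

/-- `trdeg ℚ(x, iy, eˣ, e^{iy}) = trdeg ℚ(x, y, eˣ, cos y, sin y)` for real `x, y`. -/
theorem trdeg_expField_re_imI_eq_polar (x y : ℝ) :
    Algebra.trdeg ℚ ↥(expField ![(x : ℂ), (y : ℂ) * I]) =
      Algebra.trdeg ℚ ↥(realExpPolarField x y) := by
  set A : Set ℂ := Set.range ![(x : ℂ), (y : ℂ) * I] ∪ Set.range (cexp ∘ ![(x : ℂ), (y : ℂ) * I])
    with hA
  set P : Set ℂ := {(x : ℂ), (y : ℂ), ((Real.exp x : ℝ) : ℂ), ((Real.cos y : ℝ) : ℂ),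
      ((Real.sin y : ℝ) : ℂ)} with hP
  have hIalg : ∀ t ∈ ({I} : Set ℂ), IsAlgebraic ℚ t := by
    intro t ht; rw [Set.mem_singleton_iff.mp ht]; exact isAlgebraic_I
  calc Algebra.trdeg ℚ ↥(expField ![(x : ℂ), (y : ℂ) * I])
      = Algebra.trdeg ℚ ↥(adjoin ℚ A) := rfl
    _ = Algebra.trdeg ℚ ↥(adjoin ℚ (A ∪ {I})) := (trdeg_adjoin_union_eq_of_isAlgebraic A {I} hIalg).symm
    _ = Algebra.trdeg ℚ ↥(adjoin ℚ (P ∪ {I})) :=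
        (equivOfEq (adjoin_expPair_union_I_eq_polar x y)).trdeg_eq
    _ = Algebra.trdeg ℚ ↥(adjoin ℚ P) := trdeg_adjoin_union_eq_of_isAlgebraic P {I} hIalg
    _ = Algebra.trdeg ℚ ↥(realExpPolarField x y) := rfl

/-- `ℚ(x, y, eˣ cos y, eˣ sin y)(eˣ) = ℚ(x, y, eˣ, cos y, sin y)`. -/
theorem adjoin_graph_union_exp_eq_polar (x y : ℝ) :
    adjoin ℚ (({(x : ℂ), (y : ℂ), ((Real.exp x * Real.cos y : ℝ) : ℂ),
      ((Real.exp x * Real.sin y : ℝ) : ℂ)} : Set ℂ) ∪ {((Real.exp x : ℝ) : ℂ)}) =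
    realExpPolarField x y := by
  set G : Set ℂ := {(x : ℂ), (y : ℂ), ((Real.exp x * Real.cos y : ℝ) : ℂ),
      ((Real.exp x * Real.sin y : ℝ) : ℂ)} with hG
  set P : Set ℂ := {(x : ℂ), (y : ℂ), ((Real.exp x : ℝ) : ℂ), ((Real.cos y : ℝ) : ℂ),
      ((Real.sin y : ℝ) : ℂ)} with hP
  have hE0 : ((Real.exp x : ℝ) : ℂ) ≠ 0 := by exact_mod_cast (Real.exp_pos x).ne'
  apply le_antisymm
  · have hx : (x : ℂ) ∈ adjoin ℚ P := subset_adjoin ℚ _ (by simp [hP])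
    have hy : (y : ℂ) ∈ adjoin ℚ P := subset_adjoin ℚ _ (by simp [hP])
    have he : ((Real.exp x : ℝ) : ℂ) ∈ adjoin ℚ P := subset_adjoin ℚ _ (by simp [hP])
    have hc : ((Real.cos y : ℝ) : ℂ) ∈ adjoin ℚ P := subset_adjoin ℚ _ (by simp [hP])
    have hs : ((Real.sin y : ℝ) : ℂ) ∈ adjoin ℚ P := subset_adjoin ℚ _ (by simp [hP])
    show adjoin ℚ (G ∪ _) ≤ adjoin ℚ P
    rw [adjoin_le_iff]
    rintro w (hw | hw)
    · simp only [hG, Set.mem_insert_iff, Set.mem_singleton_iff] at hw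
      rcases hw with rfl | rfl | rfl | rfl
      · exact hx
      · exact hy
      · rw [Complex.ofReal_mul]; exact mul_mem he hc
      · rw [Complex.ofReal_mul]; exact mul_mem he hs
    · rw [Set.mem_singleton_iff.mp hw]; exact he
  · have hx : (x : ℂ) ∈ adjoin ℚ (G ∪ {((Real.exp x : ℝ) : ℂ)}) :=
      subset_adjoin ℚ _ (Or.inl (by simp [hG]))
    have hy : (y : ℂ) ∈ adjoin ℚ (G ∪ {((Real.exp x : ℝ) : ℂ)}) :=
      subset_adjoin ℚ _ (Or.inl (by simp [hG]))
    have hec : ((Real.exp x * Real.cos y : ℝ) : ℂ) ∈ adjoin ℚ (G ∪ {((Real.exp x : ℝ) : ℂ)}) :=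
      subset_adjoin ℚ _ (Or.inl (by simp [hG]))
    have hes : ((Real.exp x * Real.sin y : ℝ) : ℂ) ∈ adjoin ℚ (G ∪ {((Real.exp x : ℝ) : ℂ)}) :=
      subset_adjoin ℚ _ (Or.inl (by simp [hG]))
    have he : ((Real.exp x : ℝ) : ℂ) ∈ adjoin ℚ (G ∪ {((Real.exp x : ℝ) : ℂ)}) :=
      subset_adjoin ℚ _ (Or.inr rfl)
    show adjoin ℚ P ≤ adjoin ℚ (G ∪ _)
    rw [adjoin_le_iff]
    intro w hw
    simp only [hP, Set.mem_insert_iff, Set.mem_singleton_iff] at hw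
    rcases hw with rfl | rfl | rfl | rfl | rfl
    · exact hx
    · exact hy
    · exact he
    · rw [show ((Real.cos y : ℝ) : ℂ) = ((Real.exp x * Real.cos y : ℝ) : ℂ) / ((Real.exp x : ℝ) : ℂ)
        by rw [Complex.ofReal_mul, mul_div_cancel_left₀ _ hE0]]
      exact div_mem hec he
    · rw [show ((Real.sin y : ℝ) : ℂ) = ((Real.exp x * Real.sin y : ℝ) : ℂ) / ((Real.exp x : ℝ) : ℂ)
        by rw [Complex.ofReal_mul, mul_div_cancel_left₀ _ hE0]]
      exact div_mem hes he

/-- `eˣ` is algebraic (of degree `≤ 2`) over `ℚ(x, y, eˣ cos y, eˣ sin y)`: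
`(eˣ)² = (eˣ cos y)² + (eˣ sin y)²`. -/
theorem isAlgebraic_exp_over_realExpGraphField (x y : ℝ) :
    IsAlgebraic ↥(realExpGraphField x y) ((Real.exp x : ℝ) : ℂ) := by
  set c : ℂ := ((Real.exp x * Real.cos y : ℝ) : ℂ) ^ 2 + ((Real.exp x * Real.sin y : ℝ) : ℂ) ^ 2
    with hc
  have hcmem : c ∈ realExpGraphField x y := by
    refine add_mem (pow_mem (subset_adjoin ℚ _ ?_) 2) (pow_mem (subset_adjoin ℚ _ ?_) 2) <;>
      simp
  have hsq : ((Real.exp x : ℝ) : ℂ) ^ 2 = c := by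
    rw [hc]; norm_cast
    rw [mul_pow, mul_pow, ← mul_add, Real.cos_sq_add_sin_sq, mul_one]
  refine ⟨Polynomial.X ^ 2 - Polynomial.C ⟨c, hcmem⟩, Polynomial.X_pow_sub_C_ne_zero (by norm_num) _,
    ?_⟩
  simp only [map_sub, map_pow, Polynomial.aeval_X, Polynomial.aeval_C]
  rw [hsq]
  exact sub_self _

/-- `trdeg ℚ(x, y, eˣ cos y, eˣ sin y) = trdeg ℚ(x, y, eˣ, cos y, sin y)`. -/
theorem trdeg_realExpGraphField_eq_polar (x y : ℝ) :
    Algebra.trdeg ℚ ↥(realExpGraphField x y) = Algebra.trdeg ℚ ↥(realExpPolarField x y) := by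
  set G : Set ℂ := {(x : ℂ), (y : ℂ), ((Real.exp x * Real.cos y : ℝ) : ℂ),
      ((Real.exp x * Real.sin y : ℝ) : ℂ)} with hG
  have halg : ∀ t ∈ ({((Real.exp x : ℝ) : ℂ)} : Set ℂ), IsAlgebraic ↥(adjoin ℚ G) t := by
    intro t ht; rw [Set.mem_singleton_iff.mp ht]; exact isAlgebraic_exp_over_realExpGraphField x y
  calc Algebra.trdeg ℚ ↥(realExpGraphField x y)
      = Algebra.trdeg ℚ ↥(adjoin ℚ G) := rfl
    _ = Algebra.trdeg ℚ ↥(adjoin ℚ (G ∪ {((Real.exp x : ℝ) : ℂ)})) :=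
        (trdeg_adjoin_union_eq_of_isAlgebraic_adjoin (K := ℚ) G _ halg).symm
    _ = Algebra.trdeg ℚ ↥(realExpPolarField x y) :=
        (equivOfEq (adjoin_graph_union_exp_eq_polar x y)).trdeg_eq

/-- **Dictionary.** For real `x, y`: `trdeg ℚ(x, iy, eˣ, e^{iy}) = trdeg ℚ(x, y, eˣ cos y, eˣ sin y)`,
the transcendence degree of the point of the real graph of `exp` above `(x, y)`. -/
theorem trdeg_expField_re_imI_eq_graph (x y : ℝ) :
    Algebra.trdeg ℚ ↥(expField ![(x : ℂ), (y : ℂ) * I]) =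
      Algebra.trdeg ℚ ↥(realExpGraphField x y) := by
  rw [trdeg_expField_re_imI_eq_polar, trdeg_realExpGraphField_eq_polar]

/-- Off the axes the pair `(x, iy)` is `ℚ`-linearly independent (real and imaginary parts). -/
theorem linearIndependent_re_imI {x y : ℝ} (hx : x ≠ 0) (hy : y ≠ 0) :
    LinearIndependent ℚ ![(x : ℂ), (y : ℂ) * I] := by
  refine LinearIndependent.pair_iff.mpr fun s r hsr => ?_
  rw [Rat.smul_def, Rat.smul_def] at hsr
  have hre := congrArg Complex.re hsr
  have him := congrArg Complex.im hsr
  simp only [Complex.add_re, Complex.add_im, Complex.mul_re, Complex.mul_im, Complex.ofReal_re,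
    Complex.ofReal_im, Complex.I_re, Complex.I_im, Complex.ratCast_re, Complex.ratCast_im,
    Complex.zero_re, Complex.zero_im, mul_zero, zero_mul, sub_zero, sub_self, mul_one, zero_add,
    add_zero] at hre him
  have hs : (s : ℝ) = 0 := by
    rcases mul_eq_zero.mp hre with h | h
    · exact h
    · exact absurd h hx
  have hr : (r : ℝ) = 0 := by
    rcases mul_eq_zero.mp him with h | h
    · exact h
    · exact absurd h hy
  exact ⟨by exact_mod_cast hs, by exact_mod_cast hr⟩

/-! ### The sector statement -/

/-- **The real-graph sector of `SC(2)`** (soloist formulation, `solo-Schanuel-informed`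
2026-08-19; OPEN — it contains the algebraic independence of `e` and `π`): no point of the real
surface `{(x, y, eˣ cos y, eˣ sin y)} ⊂ ℝ⁴` off the two coordinate axes has transcendence degree
`≤ 1`. Equivalent to Schanuel's inequality at all pairs `(x, iy)`, `x, y ∈ ℝ ∖ {0}`
(`realGraphSector_iff`); implied by `SchanuelRank 2`. -/
@[conjecture] def RealGraphSector : Prop :=
  ∀ x y : ℝ, x ≠ 0 → y ≠ 0 → (2 : Cardinal) ≤ Algebra.trdeg ℚ ↥(realExpGraphField x y)

/-- The sector statement is exactly Schanuel's inequality at all pairs `(x, iy)`, `x, y ∈ ℝ ∖ {0}`. -/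
theorem realGraphSector_iff :
    RealGraphSector ↔ ∀ x y : ℝ, x ≠ 0 → y ≠ 0 →
      (2 : Cardinal) ≤ Algebra.trdeg ℚ ↥(expField ![(x : ℂ), (y : ℂ) * I]) := by
  refine forall_congr' fun x => forall_congr' fun y => forall_congr' fun _ => forall_congr' fun _ => ?_
  rw [trdeg_expField_re_imI_eq_graph]

/-- Rank two of Schanuel's conjecture implies the sector statement. -/
theorem realGraphSector_of_schanuelRank_two (h : SchanuelRank 2) : RealGraphSector :=
  realGraphSector_iff.mpr fun _ _ hx hy => h _ (linearIndependent_re_imI hx hy)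

/-- The summit implies the sector statement. -/
theorem realGraphSector_of_schanuel (h : _root_.Schanuel) : RealGraphSector :=
  realGraphSector_of_schanuelRank_two (h 2)

/-! ### The axes carry points of transcendence degree one -/

/-- The point `(0, π, -1, 0)` of the real graph (above `(0, π)`, on the axis `x = 0`) has
transcendence degree `≤ 1`: its field is `ℚ(π)`. -/
theorem trdeg_realExpGraphField_zero_pi_le_one :
    Algebra.trdeg ℚ ↥(realExpGraphField 0 Real.pi) ≤ (1 : Cardinal) := by
  have hle : realExpGraphField 0 Real.pi ≤ adjoin ℚ (Set.range ![(Real.pi : ℂ)] ∪ {0, -1}) := by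
    refine adjoin.mono ℚ _ _ ?_
    intro w hw
    simp only [Real.exp_zero, one_mul, Real.cos_pi, Real.sin_pi, Complex.ofReal_zero,
      Complex.ofReal_neg, Complex.ofReal_one, Set.mem_insert_iff, Set.mem_singleton_iff] at hw
    rcases hw with rfl | rfl | rfl | rfl
    · exact Or.inr (Set.mem_insert _ _)
    · exact Or.inl ⟨0, by simp⟩
    · exact Or.inr (Set.mem_insert_of_mem _ rfl)
    · exact Or.inr (Set.mem_insert _ _)
  calc Algebra.trdeg ℚ ↥(realExpGraphField 0 Real.pi)
      ≤ Algebra.trdeg ℚ ↥(adjoin ℚ (Set.range ![(Real.pi : ℂ)] ∪ {0, -1})) := trdeg_mono hle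
    _ = Algebra.trdeg ℚ ↥(adjoin ℚ (Set.range ![(Real.pi : ℂ)])) := by
        refine trdeg_adjoin_union_eq_of_isAlgebraic _ _ ?_
        rintro t (rfl | ht)
        · exact isAlgebraic_zero
        · rw [Set.mem_singleton_iff.mp ht]; exact isAlgebraic_one.neg
    _ ≤ (1 : Cardinal) := by
        exact_mod_cast Literature.NumberTheory.Transcendental.Philippon1986_criterion.trdeg_adjoin_range_le
          ![(Real.pi : ℂ)]

/-- The point `(1, 0, e, 0)` of the real graph (above `(1, 0)`, on the axis `y = 0`) has
transcendence degree `≤ 1`: its field is `ℚ(e)`. -/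
theorem trdeg_realExpGraphField_one_zero_le_one :
    Algebra.trdeg ℚ ↥(realExpGraphField 1 0) ≤ (1 : Cardinal) := by
  have hle : realExpGraphField 1 0 ≤
      adjoin ℚ (Set.range ![((Real.exp 1 : ℝ) : ℂ)] ∪ {0, 1}) := by
    refine adjoin.mono ℚ _ _ ?_
    intro w hw
    simp only [Real.cos_zero, mul_one, Real.sin_zero, mul_zero, Complex.ofReal_zero,
      Complex.ofReal_one, Set.mem_insert_iff, Set.mem_singleton_iff] at hw
    rcases hw with rfl | rfl | rfl | rfl
    · exact Or.inr (Set.mem_insert_of_mem _ rfl)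
    · exact Or.inr (Set.mem_insert _ _)
    · exact Or.inl ⟨0, by simp⟩
    · exact Or.inr (Set.mem_insert _ _)
  calc Algebra.trdeg ℚ ↥(realExpGraphField 1 0)
      ≤ Algebra.trdeg ℚ ↥(adjoin ℚ (Set.range ![((Real.exp 1 : ℝ) : ℂ)] ∪ {0, 1})) := trdeg_mono hle
    _ = Algebra.trdeg ℚ ↥(adjoin ℚ (Set.range ![((Real.exp 1 : ℝ) : ℂ)])) := by
        refine trdeg_adjoin_union_eq_of_isAlgebraic _ _ ?_
        rintro t (rfl | ht)
        · exact isAlgebraic_zero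
        · rw [Set.mem_singleton_iff.mp ht]; exact isAlgebraic_one
    _ ≤ (1 : Cardinal) := by
        exact_mod_cast Literature.NumberTheory.Transcendental.Philippon1986_criterion.trdeg_adjoin_range_le
          ![((Real.exp 1 : ℝ) : ℂ)]

/-! ### Corners: `(1, π)` is `e ⟂ π`, `(log 2, π)` is `log 2 ⟂ π` -/

/-- The point `(1, π, -e, 0)`: `2 ≤ trdeg ℚ(1, π, e cos π, e sin π)` iff `e` and `π` are
algebraically independent. -/
theorem two_le_trdeg_realExpGraphField_one_pi_iff :
    (2 : Cardinal) ≤ Algebra.trdeg ℚ ↥(realExpGraphField 1 Real.pi) ↔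
      ExpOnePiAlgebraicIndependent := by
  rw [← trdeg_expField_re_imI_eq_graph, Complex.ofReal_one]
  exact two_le_trdeg_expField_one_piI_iff

/-- `trdeg ℚ(log 2, iπ, 2, -1) = trdeg ℚ(log 2, π)` (adjoin the algebraic number `i`). -/
theorem trdeg_expField_log_two_piI_eq :
    Algebra.trdeg ℚ ↥(expField ![((Real.log 2 : ℝ) : ℂ), (Real.pi : ℂ) * I]) =
      Algebra.trdeg ℚ ↥(adjoin ℚ ({((Real.log 2 : ℝ) : ℂ), (Real.pi : ℂ)} : Set ℂ)) := by
  rw [trdeg_expField_re_imI_eq_polar]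
  have h2 : ((Real.exp (Real.log 2) : ℝ) : ℂ) = 2 := by
    rw [Real.exp_log (by norm_num : (0 : ℝ) < 2)]; push_cast; rfl
  have hP : ({((Real.log 2 : ℝ) : ℂ), (Real.pi : ℂ), ((Real.exp (Real.log 2) : ℝ) : ℂ),
      ((Real.cos Real.pi : ℝ) : ℂ), ((Real.sin Real.pi : ℝ) : ℂ)} : Set ℂ) =
      {((Real.log 2 : ℝ) : ℂ), (Real.pi : ℂ)} ∪ {2, -1, 0} := by
    rw [h2, Real.cos_pi, Real.sin_pi]; push_cast
    ext w; simp only [Set.mem_insert_iff, Set.mem_singleton_iff, Set.mem_union]; tauto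
  have hPF : realExpPolarField (Real.log 2) Real.pi =
      adjoin ℚ (({((Real.log 2 : ℝ) : ℂ), (Real.pi : ℂ)} : Set ℂ) ∪ {2, -1, 0}) := by
    unfold realExpPolarField; rw [hP]
  refine ((equivOfEq hPF).trdeg_eq).trans (trdeg_adjoin_union_eq_of_isAlgebraic _ _ ?_)
  rintro t (rfl | rfl | ht)
  · exact_mod_cast isAlgebraic_nat 2
  · exact isAlgebraic_one.neg
  · rw [Set.mem_singleton_iff.mp ht]; exact isAlgebraic_zero

/-- **Schanuel's inequality at `(log 2, iπ)` is the algebraic independence of `log 2` and `π`**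
(open; Baker gives only linear independence). -/
theorem two_le_trdeg_expField_log_two_piI_iff :
    (2 : Cardinal) ≤ Algebra.trdeg ℚ ↥(expField ![((Real.log 2 : ℝ) : ℂ), (Real.pi : ℂ) * I]) ↔
      AlgebraicIndependent ℚ ![Real.log 2, Real.pi] := by
  rw [trdeg_expField_log_two_piI_eq]
  exact two_le_trdeg_adjoin_pair_iff (Real.log 2) Real.pi

/-- The point `(log 2, π, -2, 0)`: `2 ≤ trdeg` iff `log 2` and `π` are algebraically independent. -/
theorem two_le_trdeg_realExpGraphField_log_two_pi_iff :
    (2 : Cardinal) ≤ Algebra.trdeg ℚ ↥(realExpGraphField (Real.log 2) Real.pi) ↔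
      AlgebraicIndependent ℚ ![Real.log 2, Real.pi] := by
  rw [← trdeg_expField_re_imI_eq_graph]
  exact two_le_trdeg_expField_log_two_piI_iff

/-- The sector statement contains `e ⟂ π` (corner `(1, π)`). -/
theorem expOnePi_of_realGraphSector (h : RealGraphSector) : ExpOnePiAlgebraicIndependent :=
  two_le_trdeg_realExpGraphField_one_pi_iff.mp (h 1 Real.pi one_ne_zero Real.pi_ne_zero)

/-- The sector statement contains `log 2 ⟂ π` (corner `(log 2, π)`). -/
theorem logTwoPi_of_realGraphSector (h : RealGraphSector) :
    AlgebraicIndependent ℚ ![Real.log 2, Real.pi] :=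
  two_le_trdeg_realExpGraphField_log_two_pi_iff.mp
    (h (Real.log 2) Real.pi (Real.log_pos one_lt_two).ne' Real.pi_ne_zero)

/-- Hence rank two of Schanuel's conjecture gives `log 2 ⟂ π` through the sector. -/
theorem logTwoPi_of_schanuelRank_two (h : SchanuelRank 2) :
    AlgebraicIndependent ℚ ![Real.log 2, Real.pi] :=
  logTwoPi_of_realGraphSector (realGraphSector_of_schanuelRank_two h)

end Summit.Schanuel.Schanuel.Theorems
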